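import Mathlib.RingTheory.Etale.Weakly
import Mathlib.RingTheory.Flat.TorsionFree
import Mathlib.RingTheory.KrullDimension.Zero
import Mathlib.RingTheory.LocalRing.ResidueField.Fiber
import Literature.RingTheory.Etale.WeaklyEtaleCancel
import HarnessLib

/-!
# Weakly étale algebras over zero-dimensional rings; primes of tensor products

Two elementary inputs of the proof of Bhatt–Scholze Theorem 2.3.4 (Stacks 097Z):

* **weakly étale algebras over a field, and over zero-dimensional rings, are zero-dimensional**
  (Stacks 092I + 092F: an algebra `B` weakly étale over an absolutely flat ring is absolutely
  flat, hence every prime of `B` is maximal; we prove the dimension statement directly: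
  over a field `K`, for a prime `q ⊆ B` the domain `D = B/q` is `B`-flat by the key lemma 092C
  (the tree's `flat_algebraMap_of_weaklyEtale_left`), hence `B → D` is weakly étale, hence
  every quotient ring `D/(y)` is `D`-flat (092C twice), hence torsion-free, forcing `y` to be a
  unit; over a zero-dimensional base one argues fibrewise through Mathlib's
  `PrimeSpectrum.preimageOrderIsoFiber`):
  `krullDimLE_zero_of_weaklyEtale_field`, `krullDimLE_zero_of_weaklyEtale`;
* **primes of `B ⊗_A C` over prescribed primes of `B` and `C` with the same contraction to `A`**
  (`Spec(B ⊗_A C) → Spec B ×_{Spec A} Spec C` is surjective: the fibre is the spectrum of the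
  non-zero ring `κ(q) ⊗_{κ(p)} κ(𝔠)`): `exists_isPrime_tensorProduct_comap_eq`.

Also: `weaklyEtale_quotient_of_flat` (a flat quotient ring is weakly étale).

## References

* The Stacks Project, Tags 092C, 092F, 092I (weakly étale and absolutely flat rings),
  Tag 00E6-style fibre products of spectra. [StacksProject]
* B. Bhatt, P. Scholze, *The pro-étale topology for schemes*, Astérisque 369 (2015):
  Lemma 2.2.3 and the proof of Thm. 2.3.4. [BhattScholze2015]

## Design notes

* Theorems only (D-0026). Mathlib searched/used: `Algebra.WeaklyEtale` (base change instance),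
  `Module.Flat.isSMulRegular_of_isRegular`, `Ring.KrullDimLE.mk₀`,
  `PrimeSpectrum.preimageOrderIsoFiber`, `Ideal.ResidueField.map(_algebraMap)`,
  `Module.FaithfullyFlat.rTensor_nontrivial`; from the tree:
  `Literature.RingTheory.Etale.flat_algebraMap_of_weaklyEtale_left` (Stacks 092C). Nothing
  restated.
-/

universe u

open TensorProduct

namespace Literature.RingTheory.Etale

/-! ### Flat quotients are weakly étale -/

section Quotient

variable {B : Type*} [CommRing B] (I : Ideal B)

/-- Every element of `(B/I) ⊗_B (B/I)` is of the form `x ⊗ 1`. [folklore] -/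
theorem exists_eq_tmul_one_quotient (z : (B ⧸ I) ⊗[B] (B ⧸ I)) :
    ∃ x : B ⧸ I, z = x ⊗ₜ[B] 1 := by
  induction z using TensorProduct.induction_on with
  | zero => exact ⟨0, by rw [TensorProduct.zero_tmul]⟩
  | tmul x y =>
    obtain ⟨b, rfl⟩ := Ideal.Quotient.mk_surjective y
    refine ⟨b • x, ?_⟩
    have hb : Ideal.Quotient.mk I b = b • (1 : B ⧸ I) := by
      rw [Algebra.smul_def, mul_one]
      rfl
    rw [hb, TensorProduct.smul_tmul]
  | add x y hx hy =>
    obtain ⟨a, rfl⟩ := hx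
    obtain ⟨b, rfl⟩ := hy
    exact ⟨a + b, by rw [TensorProduct.add_tmul]⟩

/-- The multiplication map `(B/I) ⊗_B (B/I) → B/I` is bijective. [folklore] -/
theorem lmul'_quotient_bijective :
    Function.Bijective (Algebra.TensorProduct.lmul' B (S := B ⧸ I)) := by
  refine ⟨fun z w h => ?_, fun x => ⟨x ⊗ₜ 1, by simp⟩⟩
  obtain ⟨x, rfl⟩ := exists_eq_tmul_one_quotient I z
  obtain ⟨y, rfl⟩ := exists_eq_tmul_one_quotient I w
  simp only [Algebra.TensorProduct.lmul'_apply_tmul, mul_one] at h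
  rw [h]

/-- **A flat quotient ring is weakly étale**: if `B/I` is `B`-flat then `B → B/I` is weakly
étale (its diagonal is an isomorphism). [cite: StacksProject, Tag 092N] -/
theorem weaklyEtale_quotient_of_flat [Module.Flat B (B ⧸ I)] : Algebra.WeaklyEtale B (B ⧸ I) where
  flat_lmul' := RingHom.Flat.of_bijective (lmul'_quotient_bijective I)

end Quotient

/-! ### Weakly étale algebras over fields and over zero-dimensional rings -/

section Field

variable (K B : Type u) [Field K] [CommRing B] [Algebra K B]

/-- **A weakly étale algebra over a field is zero-dimensional** (every prime is maximal;
Stacks 092I/092F: it is absolutely flat). For a prime `q`, `D = B/q` is `B`-flat (092C), so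
`B → D` is weakly étale; for `y ≠ 0` in `D` the ring `D/(y)` is then `D`-flat (092C twice), hence
torsion-free over the domain `D`, so `y · 1 = 0` forces `D/(y) = 0`, i.e. `y` is a unit.
[cite: StacksProject, Tags 092C, 092F, 092I] -/
theorem krullDimLE_zero_of_weaklyEtale_field [Algebra.WeaklyEtale K B] : Ring.KrullDimLE 0 B := by
  refine Ring.KrullDimLE.mk₀ fun q hq => ?_
  refine (Ideal.Quotient.maximal_ideal_iff_isField_quotient q).2 ?_
  -- `D = B/q` is `B`-flat, hence weakly étale over `B`
  haveI : Module.Flat B (B ⧸ q) := flat_algebraMap_of_weaklyEtale_left K B (B ⧸ q)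
  haveI : Algebra.WeaklyEtale B (B ⧸ q) := weaklyEtale_quotient_of_flat q
  refine ⟨⟨0, 1, zero_ne_one⟩, mul_comm, fun {y} hy => ?_⟩
  -- `N = D/(y)` is `D`-flat
  let J : Ideal (B ⧸ q) := Ideal.span {y}
  haveI : Module.Flat B ((B ⧸ q) ⧸ J) := flat_algebraMap_of_weaklyEtale_left K B ((B ⧸ q) ⧸ J)
  haveI : Module.Flat (B ⧸ q) ((B ⧸ q) ⧸ J) :=
    flat_algebraMap_of_weaklyEtale_left B (B ⧸ q) ((B ⧸ q) ⧸ J)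
  -- torsion-freeness: `y • 1 = 0` in `D/(y)` forces `1 = 0`
  have hreg : IsSMulRegular ((B ⧸ q) ⧸ J) y :=
    Module.Flat.isSMulRegular_of_isRegular (IsRegular.of_ne_zero hy)
  have h1 : (1 : (B ⧸ q) ⧸ J) = 0 := by
    refine hreg ?_
    have e1 : y • (1 : (B ⧸ q) ⧸ J) = algebraMap (B ⧸ q) ((B ⧸ q) ⧸ J) y :=
      (Algebra.algebraMap_eq_smul_one y).symm
    have e2 : algebraMap (B ⧸ q) ((B ⧸ q) ⧸ J) y = 0 := by
      rw [Ideal.Quotient.algebraMap_eq, Ideal.Quotient.eq_zero_iff_mem]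
      exact Ideal.subset_span rfl
    change y • (1 : (B ⧸ q) ⧸ J) = y • (0 : (B ⧸ q) ⧸ J)
    rw [smul_zero]
    exact e1.trans e2
  have hJ : J = ⊤ := by
    rw [← Ideal.Quotient.zero_eq_one_iff, h1]
  obtain ⟨z, hz⟩ := Ideal.span_singleton_eq_top.1 hJ |>.exists_right_inv
  exact ⟨z, hz⟩

end Field

section ZeroDim

variable (R S : Type u) [CommRing R] [CommRing S] [Algebra R S]

/-- **A weakly étale algebra over a zero-dimensional ring is zero-dimensional**: two comparable
primes `I ≤ J` of `S` contract to the same (maximal) prime `p` of `R`, so they lie in the fibre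
`Spec(κ(p) ⊗_R S)` (Mathlib's `PrimeSpectrum.preimageOrderIsoFiber`), which is zero-dimensional
as `κ(p) ⊗_R S` is weakly étale over the field `κ(p)`. [cite: StacksProject, Tags 092F, 092I] -/
theorem krullDimLE_zero_of_weaklyEtale [Ring.KrullDimLE 0 R] [Algebra.WeaklyEtale R S] :
    Ring.KrullDimLE 0 S := by
  refine Ring.KrullDimLE.mk₀ fun I hI => ?_
  obtain ⟨J, hJ, hIJ⟩ := Ideal.exists_le_maximal I hI.ne_top
  suffices h : I = J by rw [h]; exact hJ
  -- contractions agree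
  haveI := hJ.isPrime
  have hpI : (I.comap (algebraMap R S)).IsMaximal := Ideal.IsPrime.isMaximal' inferInstance
  have hcomap : I.comap (algebraMap R S) = J.comap (algebraMap R S) :=
    hpI.eq_of_le (Ideal.IsPrime.ne_top' (I := J.comap (algebraMap R S))) (Ideal.comap_mono hIJ)
  let 𝔭 : PrimeSpectrum R := ⟨I.comap (algebraMap R S), inferInstance⟩
  let x₁ : PrimeSpectrum.comap (algebraMap R S) ⁻¹' {𝔭} := ⟨⟨I, hI⟩, rfl⟩
  let x₂ : PrimeSpectrum.comap (algebraMap R S) ⁻¹' {𝔭} :=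
    ⟨⟨J, hJ.isPrime⟩, PrimeSpectrum.ext hcomap.symm⟩
  let e := PrimeSpectrum.preimageOrderIsoFiber R S 𝔭
  have hle : e x₁ ≤ e x₂ := e.map_rel_iff.2 hIJ
  -- the fibre is zero-dimensional
  haveI : Ring.KrullDimLE 0 (𝔭.asIdeal.Fiber S) :=
    krullDimLE_zero_of_weaklyEtale_field 𝔭.asIdeal.ResidueField _
  have hmax : (e x₁).asIdeal.IsMaximal := Ideal.IsPrime.isMaximal' (e x₁).2
  have heq : e x₁ = e x₂ :=
    PrimeSpectrum.ext (hmax.eq_of_le (e x₂).2.ne_top hle)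
  have := e.injective heq
  exact congrArg (fun x : PrimeSpectrum.comap (algebraMap R S) ⁻¹' {𝔭} => x.1.asIdeal) this

end ZeroDim

/-! ### Primes of a tensor product over prescribed primes -/

section TensorPrime

variable {A B C : Type*} [CommRing A] [CommRing B] [CommRing C] [Algebra A B] [Algebra A C]

/-- **`Spec(B ⊗_A C) → Spec B ×_{Spec A} Spec C` is surjective**: given primes `q ⊆ B` and
`𝔠 ⊆ C` with the same contraction `p` to `A`, there is a prime of `B ⊗_A C` contracting to `q`
and to `𝔠` (any prime of the non-zero ring `κ(q) ⊗_{κ(p)} κ(𝔠)` pulls back to one).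
[cite: StacksProject, Tag 00E6] -/
theorem exists_isPrime_tensorProduct_comap_eq (q : Ideal B) [q.IsPrime] (𝔠 : Ideal C) [𝔠.IsPrime]
    (h : q.comap (algebraMap A B) = 𝔠.comap (algebraMap A C)) :
    ∃ P : Ideal (B ⊗[A] C), P.IsPrime ∧
      P.comap (Algebra.TensorProduct.includeLeftRingHom : B →+* B ⊗[A] C) = q ∧
      P.comap ((Algebra.TensorProduct.includeRight : C →ₐ[A] B ⊗[A] C) : C →+* B ⊗[A] C) = 𝔠 := by
  -- the common contraction and the residue fields
  let p : Ideal A := q.comap (algebraMap A B)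
  haveI : p.IsPrime := Ideal.comap_isPrime _ _
  let k := p.ResidueField
  let Kq := q.ResidueField
  let Kc := 𝔠.ResidueField
  let fq : k →+* Kq := Ideal.ResidueField.map p q (algebraMap A B) rfl
  let fc : k →+* Kc := Ideal.ResidueField.map p 𝔠 (algebraMap A C) h
  letI : Algebra k Kq := fq.toAlgebra
  letI : Algebra k Kc := fc.toAlgebra
  -- compatibility of the residue-field structures with `A`
  have hfq : ∀ a : A, fq (algebraMap A k a) = algebraMap B Kq (algebraMap A B a) := fun a =>
    Ideal.ResidueField.map_algebraMap p q (algebraMap A B) rfl a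
  have hfc : ∀ a : A, fc (algebraMap A k a) = algebraMap C Kc (algebraMap A C a) := fun a =>
    Ideal.ResidueField.map_algebraMap p 𝔠 (algebraMap A C) h a
  haveI : IsScalarTower A k Kq := IsScalarTower.of_algebraMap_eq fun a => by
    rw [IsScalarTower.algebraMap_apply A B Kq]
    exact (hfq a).symm
  haveI : IsScalarTower A k Kc := IsScalarTower.of_algebraMap_eq fun a => by
    rw [IsScalarTower.algebraMap_apply A C Kc]
    exact (hfc a).symm
  -- `T = κ(q) ⊗_{κ(p)} κ(𝔠)` is a non-zero ring
  let T := Kq ⊗[k] Kc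
  haveI : Module.Free k Kc := Module.Free.of_divisionRing k Kc
  haveI : Module.FaithfullyFlat k Kc := inferInstance
  haveI : Nontrivial T := Module.FaithfullyFlat.rTensor_nontrivial k Kc Kq
  -- the two structure maps as `A`-algebra maps
  let gB : B →ₐ[A] T :=
    (Algebra.TensorProduct.includeLeft : Kq →ₐ[A] T).comp (IsScalarTower.toAlgHom A B Kq)
  let gC : C →ₐ[A] T :=
    ((Algebra.TensorProduct.includeRight : Kc →ₐ[k] T).restrictScalars A).comp
      (IsScalarTower.toAlgHom A C Kc)
  let ψ : B ⊗[A] C →ₐ[A] T := Algebra.TensorProduct.lift gB gC fun _ _ => Commute.all _ _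
  -- any prime of `T` pulls back to the required prime
  obtain ⟨𝔪, h𝔪⟩ := Ideal.exists_maximal T
  refine ⟨𝔪.comap (ψ : B ⊗[A] C →+* T), Ideal.comap_isPrime _ _, ?_, ?_⟩
  · -- contraction to `B`: through the field `κ(q)`
    rw [Ideal.comap_comap]
    have hcomp : (ψ : B ⊗[A] C →+* T).comp
        (Algebra.TensorProduct.includeLeftRingHom : B →+* B ⊗[A] C) =
        (Algebra.TensorProduct.includeLeftRingHom : Kq →+* T).comp (algebraMap B Kq) := by
      ext b
      change ψ (b ⊗ₜ 1) = _
      simp only [ψ, Algebra.TensorProduct.lift_tmul, map_one, mul_one]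
      rfl
    rw [hcomp, ← Ideal.comap_comap]
    haveI : (𝔪.comap (Algebra.TensorProduct.includeLeftRingHom : Kq →+* T)).IsPrime :=
      Ideal.comap_isPrime _ _
    rw [Ideal.eq_bot_of_prime (𝔪.comap (Algebra.TensorProduct.includeLeftRingHom : Kq →+* T)),
      ← RingHom.ker_eq_comap_bot]
    exact Ideal.ker_algebraMap_residueField q
  · -- contraction to `C`: through the field `κ(𝔠)`
    rw [Ideal.comap_comap]
    have hcomp : (ψ : B ⊗[A] C →+* T).comp
        ((Algebra.TensorProduct.includeRight : C →ₐ[A] B ⊗[A] C) : C →+* B ⊗[A] C) =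
        ((Algebra.TensorProduct.includeRight : Kc →ₐ[k] T) : Kc →+* T).comp (algebraMap C Kc) := by
      ext c
      change ψ (1 ⊗ₜ c) = _
      simp only [ψ, Algebra.TensorProduct.lift_tmul, map_one, one_mul]
      rfl
    rw [hcomp, ← Ideal.comap_comap]
    haveI : (𝔪.comap ((Algebra.TensorProduct.includeRight : Kc →ₐ[k] T) : Kc →+* T)).IsPrime :=
      Ideal.comap_isPrime _ _
    rw [Ideal.eq_bot_of_prime
        (𝔪.comap ((Algebra.TensorProduct.includeRight : Kc →ₐ[k] T) : Kc →+* T)),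
      ← RingHom.ker_eq_comap_bot]
    exact Ideal.ker_algebraMap_residueField 𝔠

end TensorPrime

end Literature.RingTheory.Etale
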